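import Literature.MathematicalPhysics.QuantumFieldTheory.Balaban1983to89.B9Eq386LipschitzH1
import Literature.MathematicalPhysics.QuantumFieldTheory.Balaban1983to89.B9Eq384LaplaceALipschitzTwoBackgrounds

/-!
# `Balaban1983to89.B9Eq386LipschitzH1TwoBackgrounds` — T. Bałaban, *Propagators for lattice gauge theories in a background field*, Commun. Math.
# Phys. **99** (1985) 389–434 [Balaban1985BackgroundPropagators] Thm 3.4 p. 400 ∕ (3.86) p. 407 with (3.126) p. 420: AT A FIXED LATTICE THE pub-balaban
# NE9 CHAIN'S `G₁(U) = Δ_a(U)⁻¹` AND `H₁(U) = G₁Q†(QG₁Q†)⁻¹` ARE LIPSCHITZ IN THE BACKGROUND BETWEEN TWO SMALL-BOND BACKGROUNDS —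
# `‖G₁(U) − G₁(U′)‖ ≤ C₁·δ`, `‖H₁(U) − H₁(U′)‖ ≤ C₂·δ` for `‖U(b) − 1‖, ‖U′(b) − 1‖ ≤ ε ≤ ε₇`, `‖U(b) − U′(b)‖ ≤ δ`: print's «small perturbations of the
# operators depending on U only» between TWO general `U`'s of the small-bond ball, by the resolvent algebra of `B9Eq386ResolventLetters` on the
# two-background letters `‖Δ_a(U) − Δ_a(U′)‖ ≤ C_Δ·δ` and `‖Q(U) − Q(U′)‖ ≤ C_Q·δ` of this lineage

statement-level skeleton of published theorems with citation tags; proofs where landed; nothing here is a claim about the Yang–Mills mass gap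

PDF held: `paper:balaban1985-cmp99-background-propagators` (journal page = PDF page + 388); pp. 400, 407, 420 through the verbatim quotations of
`B9Eq386LipschitzH1` (NE9 owner gen 81), whose proof this file runs a second time between two backgrounds.

CITATION HEADER (lean-in-tree rule 2026-08-18).  Audit cell `pub-balaban`, sub-cell `t4`, NE9 crux team (2): LEAF PROVER 04
(`b2b-balaban-t4-ne9-formalise-leaf-04` gen 73) — the TWO-BACKGROUND twin of the NE9 owner's (Q2) `B9Eq386LipschitzH1.exists_lipschitz_G1_H1_at_flat`,
the third junction above this lineage's two-background letters for the owner's census item (i) «two general small fields» (journal `CLAIMS.log`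
l.42142): (δ_Q)₂ `B9Eq379QLipschitzGeneral`, (B)₂, (ρ′)₂, (Q3a)₂, (Δ′)₂ `B9Ineq369CurvatureTwoBackgrounds`, (Q1)₂ `B9Eq384LaplaceALipschitzTwoBackgrounds`.

THE PRINT (as quoted in `B9Eq386LipschitzH1`).  p. 400, Thm 3.4: *«… describing these analytic extensions as small perturbations of the operators
depending on U only»*; p. 407, (3.86): *«G(U′U) = G(U)(I − V(A)G(U))⁻¹ = Σ_{n=0}^∞ G(U)(V(A)G(U))ⁿ»* — at a GENERAL `U`; p. 420, (3.126): *«HB = GQ*(QGQ*)⁻¹B»*.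

WHAT IS PROVED (sorry-free; no `Prop` placeholder; no inequality of the paper asserted).
* **`exists_lipschitz_G1_H1_twoBackgrounds`** — `∃ C₁ C₂ ε₇ > 0 ∀ U U′` (their `QtorusW` letters, `‖U(b) − 1‖, ‖U′(b) − 1‖ ≤ ε ≤ ε₇`, `‖U(b) − U′(b)‖ ≤ δ`,
  `hRS`, `hRS′`) `∀ hpos hQ` (at `U`) `∀ hpos′ hQ′` (at `U′`): `‖G₁(U)z − G₁(U′)z‖ ≤ C₁·δ·‖z‖` and `‖H₁(U)b − H₁(U′)b‖ ≤ C₂·δ·‖b‖` —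
  `B9Eq386ResolventLetters.norm_G1K_sub_le` ∕ `norm_H1K_sub_le` with: the uniform coercivity `γ₁` (`B9Thm311SmallFieldGreen`) and operator bound `MT`
  (`B9Eq3126H1Bound`) AT BOTH backgrounds, `δT = C_Δ·δ` ((Q1)₂ §2), `δQ = C_Q·δ` ((δ_Q)₂ §6, `δ ∧ 2ε ≤ δ`), `MQ = ‖Q(1)‖ + C_Q^♭`, `μQ = μ_{Q(1)†}∕2` at both
  (this lineage's flat `δ_Q`).
MODEL / HONEST SCOPE.  [folklore] finite-dimensional perturbation theory at a FIXED lattice; `C₁, C₂, ε₇` depend on `L, m, η, c₀, c₁, a, M_φ, M_φ′, C_τ`;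
both backgrounds in the small-bond ball; NOT analyticity in `A`, NOT uniformity in the lattice, NOT `𝔊(U)` (the (Q3) twin; next); NOT summit progress
(cell pub-balaban: NE9 NOT PRINTED ∕ NOT PROVED; spine PROVED 0∕9; rung (B)+1 finite T⁴ — NOT infinite volume, NOT mass gap, NOT BetaPertH, NOT Clay).
NEW file importing `B9Eq386LipschitzH1`, `B9Eq384LaplaceALipschitzTwoBackgrounds`; nothing of the NE9-owner lineage's files is modified.
Net new unproved facts: 0.
-/

noncomputable section

open scoped InnerProductSpace ComplexConjugate

namespace Literature.MathematicalPhysics.QuantumFieldTheory.Balaban1983to89.B9Eq386LipschitzH1TwoBackgrounds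

open B4Sect5Torus (TSite)
open B9SectCLatticeCarrier (Bond)
open B7Prop1Explicit (U1 Wcx boxVec)
open B9Eq311L2Pairing (WL2)
open B9Eq319QprimeTorus (fineP)
open B11Eq103H1Complex (SiteL2K BondL2K covDerivL2K covDivL2K laplaceAK laplaceALatticeK H1LatticeK G1LatticeK adjoint_injective_of_surjective)
open B9Eq310HessianOperator (adTransportW hessOp)
open B9Eq326OperatorAssembly (RofU)
open B9Eq315QTorus (perCfg cornerSite QtorusW laplaceAofBackground)
open B9Eq315QTorusOnto (liftSite perSite_liftSite QtorusW_surjective)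
open B5Eq172FlatCoercivity (hU1_one hreg_one)
open B9Eq373DerivativeRemainderL2 (norm_adjoint_apply_le)
open B9Eq315QLipschitz (norm_QtorusW_sub_flat_le)
open B9Thm311SmallFieldGreen (exists_coercive_laplaceA_of_small_field)
open B9Eq3126GreenLetters (exists_modulus_of_injective adjoint_injective_of_modulus)
open B9Eq3126H1Bound (norm_laplaceAofBackground_le)
open B9Eq386ResolventLetters (norm_G1K_sub_le norm_H1K_sub_le)
open B9Eq379QLipschitzGeneral (norm_QtorusW_sub_QtorusW_le_of_bonds)
open B9Eq384LaplaceALipschitzTwoBackgrounds (exists_laplaceAofBackground_sub_laplaceAofBackground_le)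

variable {d : ℕ} (L : ℕ) [NeZero L] (m : Fin d → ℕ) [∀ i, NeZero (fineP L m i)] (hL : 1 ≤ L)
  {𝔸 : Type*} [NormedRing 𝔸] [NormedAlgebra ℂ 𝔸] [CompleteSpace 𝔸] [NormOneClass 𝔸]
  {W : Type*} [NormedAddCommGroup W] [InnerProductSpace ℂ W] [FiniteDimensional ℂ W] (φ : W ≃ₗ[ℂ] 𝔸) {c₀ c₁ : ℝ} [Fact (0 < c₀)] [Fact (0 < c₁)]

section Assembled

variable [StarRing 𝔸] [NormedStarGroup 𝔸] [StarModule ℂ 𝔸]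

set_option maxHeartbeats 800000 in
/-- **THM 3.4 ∕ (3.86) ∕ (3.126) AT A FIXED LATTICE, FIRST ORDER BETWEEN TWO SMALL-BOND BACKGROUNDS: `‖G₁(U) − G₁(U′)‖ ≤ C₁·δ`, `‖H₁(U) − H₁(U′)‖ ≤ C₂·δ`**
for the chain's `G₁(V) = G1LatticeK hpos` and `H₁(V) = H1LatticeK hpos hQ` (ANY positivity ∕ surjectivity witnesses at `U` and at `U′`), at every pair of
backgrounds of E162's data with `‖U(b) − 1‖, ‖U′(b) − 1‖ ≤ ε ≤ ε₇`, `‖U(b) − U′(b)‖ ≤ δ`, `hRS`, `hRS′` — the owner's (Q2) proof with `U′` for `1`: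
`δ_Δ = C_Δ·δ` ((Q1)₂ §2), `δ_Q = C_Q·δ` ((δ_Q)₂ §6), the uniform coercivity `γ₁` and operator bound `MT` of `Δ_a` at both backgrounds, the flat
modulus of `Q(1)†` halved at both. [cite: Balaban1985BackgroundPropagators, Thm 3.4 p.400, (3.86) p.407, (3.126) p.420, Thm 3.11 p.416; Balaban1985Variational, (45) p.285] -/
theorem exists_lipschitz_G1_H1_twoBackgrounds {η : ℝ} (hη : η ≠ 0) {a : ℝ} (ha : 0 < a) {Mφ Mφ' : ℝ} (hMφ : 0 ≤ Mφ) (hMφ' : 0 ≤ Mφ')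
    (hφ : ∀ w, ‖φ w‖ ≤ Mφ * ‖w‖) (hφ' : ∀ X, ‖φ.symm X‖ ≤ Mφ' * ‖X‖) (τ : 𝔸 →ₗ[ℂ] ℂ) {Cτ : ℝ} (hτ : ∀ X, ‖τ X‖ ≤ Cτ * ‖X‖) (hCτ : 0 ≤ Cτ) :
    ∃ C₁ C₂ ε₇ : ℝ, 0 < C₁ ∧ 0 < C₂ ∧ 0 < ε₇ ∧ ∀ (U U' : Bond d (fineP L m) → 𝔸ˣ) {α α' : ℝ} (hα1 : α ≤ 1 / 64)
      (hU1 : ∀ (x : B7Prop1Explicit.Site d) (κ : Fin d), perCfg (fineP L m) U x κ ∈ U1 𝔸)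
      (hreg : ∀ (y : TSite d m) (κ : Fin d) (r : Fin d → Fin L), ‖((Wcx L (perCfg (fineP L m) U) (cornerSite L y) κ (boxVec L r) : 𝔸ˣ) : 𝔸) - 1‖ ≤ α)
      (hα1' : α' ≤ 1 / 64)
      (hU1' : ∀ (x : B7Prop1Explicit.Site d) (κ : Fin d), perCfg (fineP L m) U' x κ ∈ U1 𝔸)
      (hreg' : ∀ (y : TSite d m) (κ : Fin d) (r : Fin d → Fin L), ‖((Wcx L (perCfg (fineP L m) U') (cornerSite L y) κ (boxVec L r) : 𝔸ˣ) : 𝔸) - 1‖ ≤ α')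
      {ε δ : ℝ}, 0 ≤ ε → ε ≤ ε₇ → 0 ≤ δ → (∀ b, ‖(U b : 𝔸) - 1‖ ≤ ε) → (∀ b, ‖(U' b : 𝔸) - 1‖ ≤ ε) →
      (∀ b, ‖(U b : 𝔸) - (U' b : 𝔸)‖ ≤ δ) →
      (∀ (b : Bond d (fineP L m)) (v u : W), ⟪adTransportW φ U b v, u⟫_ℂ = ⟪v, adTransportW φ (fun b => (U b)⁻¹) b u⟫_ℂ) →
      (∀ (b : Bond d (fineP L m)) (v u : W), ⟪adTransportW φ U' b v, u⟫_ℂ = ⟪v, adTransportW φ (fun b => (U' b)⁻¹) b u⟫_ℂ) →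
      ∀ (hpos : ∀ x : BondL2K ℂ d (fineP L m) c₀ W, x ≠ 0 →
          0 < RCLike.re ⟪x, laplaceAofBackground L m hL φ U hα1 hU1 hreg τ η (c₀ := c₀) (c₁ := c₁) a x⟫_ℂ)
        (hQ : Function.Surjective (QtorusW L m hL φ U hα1 hU1 hreg (c₀ := c₀) (c₁ := c₁)))
        (hpos' : ∀ x : BondL2K ℂ d (fineP L m) c₀ W, x ≠ 0 →
          0 < RCLike.re ⟪x, laplaceAofBackground L m hL φ U' hα1' hU1' hreg' τ η (c₀ := c₀) (c₁ := c₁) a x⟫_ℂ)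
        (hQ' : Function.Surjective (QtorusW L m hL φ U' hα1' hU1' hreg' (c₀ := c₀) (c₁ := c₁))),
      (∀ z : BondL2K ℂ d (fineP L m) c₀ W,
        ‖G1LatticeK (Δ₁ := hessOp φ η U τ) (Q := QtorusW L m hL φ U hα1 hU1 hreg (c₀ := c₀) (c₁ := c₁)) hpos z -
          G1LatticeK (Δ₁ := hessOp φ η U' τ) (Q := QtorusW L m hL φ U' hα1' hU1' hreg' (c₀ := c₀) (c₁ := c₁)) hpos' z‖ ≤ C₁ * δ * ‖z‖) ∧
      (∀ b : BondL2K ℂ d m c₁ W,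
        ‖H1LatticeK (Δ₁ := hessOp φ η U τ) (Q := QtorusW L m hL φ U hα1 hU1 hreg (c₀ := c₀) (c₁ := c₁)) hpos hQ b -
          H1LatticeK (Δ₁ := hessOp φ η U' τ) (Q := QtorusW L m hL φ U' hα1' hU1' hreg' (c₀ := c₀) (c₁ := c₁)) hpos' hQ' b‖ ≤ C₂ * δ * ‖b‖) := by
  have hc₀ : 0 < c₀ := Fact.out
  have hL0 : (0 : ℝ) < L := by exact_mod_cast hL
  have hαL0 : 50 * (d + 1) * (0 : ℝ) * (L : ℝ) ^ d ≤ 1 / 2 := by norm_num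
  -- the uniform coercivity of `Δ_a(V)` on the small-bond ball
  obtain ⟨γ₁, ε₃, hγ₁, hε₃, Hc⟩ := exists_coercive_laplaceA_of_small_field L m hL φ (c₀ := c₀) (c₁ := c₁) hη ha hMφ hMφ' hφ hφ' τ hτ hCτ
  -- (Q1)₂ §2: `δ_Δ = C_Δ·δ`
  obtain ⟨CΔ, ε₆, hCΔ, hε₆, HΔ⟩ :=
    exists_laplaceAofBackground_sub_laplaceAofBackground_le L m hL φ (c₀ := c₀) (c₁ := c₁) hη a hMφ hMφ' hφ hφ' τ hτ hCτ
  -- the flat averaging: operator norm `MQ1` and the modulus `μQ1` of `Q(1)†`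
  obtain ⟨MQ1, hMQ1def⟩ : ∃ MQ1 : ℝ, MQ1 = ‖LinearMap.toContinuousLinearMap
    (QtorusW L m hL φ (fun _ => 1) (show (0 : ℝ) ≤ 1 / 64 by norm_num) (hU1_one L m) (hreg_one L m) (c₀ := c₀) (c₁ := c₁))‖ := ⟨_, rfl⟩
  have hMQ1 : 0 ≤ MQ1 := by rw [hMQ1def]; positivity
  have hQ1 : ∀ x : BondL2K ℂ d (fineP L m) c₀ W,
      ‖QtorusW L m hL φ (fun _ => 1) (show (0 : ℝ) ≤ 1 / 64 by norm_num) (hU1_one L m) (hreg_one L m) (c₀ := c₀) (c₁ := c₁) x‖ ≤ MQ1 * ‖x‖ :=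
    fun x => by
      rw [hMQ1def]
      exact (LinearMap.toContinuousLinearMap
        (QtorusW L m hL φ (fun _ => 1) (show (0 : ℝ) ≤ 1 / 64 by norm_num) (hU1_one L m) (hreg_one L m) (c₀ := c₀) (c₁ := c₁))).le_opNorm x
  obtain ⟨μQ1, hμQ1, hQ1adj⟩ := exists_modulus_of_injective
    (LinearMap.adjoint (QtorusW L m hL φ (fun _ => 1) (show (0 : ℝ) ≤ 1 / 64 by norm_num) (hU1_one L m) (hreg_one L m) (c₀ := c₀) (c₁ := c₁)))
    (adjoint_injective_of_surjective _ (QtorusW_surjective L m hL (fun _ => 1) (show (0 : ℝ) ≤ 1 / 64 by norm_num) (hU1_one L m) (hreg_one L m) hαL0 φ))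
  -- the constants
  obtain ⟨KR, hKRdef⟩ : ∃ KR : ℝ, KR = 2 * Mφ * Mφ' := ⟨_, rfl⟩
  have hKR : 0 ≤ KR := by rw [hKRdef]; positivity
  obtain ⟨N, hNdef⟩ : ∃ N : ℝ, N = ((2 * (d * L) + L + L : ℕ) : ℝ) := ⟨_, rfl⟩
  have hN1 : (1 : ℝ) ≤ N := by
    have : 1 ≤ 2 * (d * L) + L + L := by omega
    rw [hNdef]; exact_mod_cast this
  have hN : 0 < N := by linarith
  obtain ⟨CQ, hCQdef⟩ : ∃ CQ : ℝ, CQ = Mφ' * Mφ * Real.sqrt (c₁ * Fintype.card (Bond d m) / c₀) * (102 * (d + 1) ^ 2 * L) := ⟨_, rfl⟩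
  have hCQ : 0 ≤ CQ := by rw [hCQdef]; positivity
  obtain ⟨CQ₂, hCQ₂def⟩ : ∃ CQ₂ : ℝ, CQ₂ = Mφ' * Mφ * Real.sqrt (c₁ * Fintype.card (Bond d m) / c₀) * (75497472 * ((d : ℝ) + 1) * N) := ⟨_, rfl⟩
  have hCQ₂ : 0 ≤ CQ₂ := by rw [hCQ₂def]; positivity
  obtain ⟨MT, hMTdef⟩ : ∃ MT : ℝ, MT = 64 * d * ‖((η : ℂ))⁻¹‖ ^ 2 + 16 * ‖((η : ℂ))⁻¹‖ ^ 2 * d +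
      32 * d * Cτ * Mφ ^ 2 * (|η| ^ d / c₀) * (‖((η : ℂ))⁻¹‖ ^ 2 * (4 * 1)) + (MQ1 + CQ) * (|a| * (MQ1 + CQ)) + 1 := ⟨_, rfl⟩
  have hMT0 : 0 < MT := by rw [hMTdef]; positivity
  obtain ⟨κ, hκdef⟩ : ∃ κ : ℝ, κ = γ₁ * (μQ1 / 2) ^ 2 / MT ^ 2 := ⟨_, rfl⟩
  have hκ : 0 < κ := by rw [hκdef]; positivity
  refine ⟨γ₁⁻¹ * CΔ * γ₁⁻¹,
    γ₁⁻¹ * CΔ * γ₁⁻¹ * ((MQ1 + CQ) * κ⁻¹) + γ₁⁻¹ * (CQ₂ * κ⁻¹) +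
      γ₁⁻¹ * ((MQ1 + CQ) * (κ⁻¹ * (CQ₂ * (γ₁⁻¹ * (MQ1 + CQ)) + (MQ1 + CQ) * (γ₁⁻¹ * CΔ * γ₁⁻¹ * (MQ1 + CQ)) + (MQ1 + CQ) * (γ₁⁻¹ * CQ₂)) * κ⁻¹)) + 1,
    min ε₃ (min (1 / (KR + 1)) (min 1 (min (μQ1 / (2 * CQ + 1)) (min ε₆ (min (1 / (256 * ((d : ℝ) + 1) * L)) (1 / (24576 * N))))))),
    by positivity, by positivity, by positivity, ?_⟩
  intro U U' α α' hα1 hU1 hreg hα1' hU1' hreg' ε δ hε hε₇ hδ hUε hU'ε hUU' hRS hRS' hpos hQs hpos' hQs'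
  have hεε₃ : ε ≤ ε₃ := hε₇.trans (min_le_left _ _)
  have hε1' : ε ≤ 1 / (KR + 1) := hε₇.trans ((min_le_right _ _).trans (min_le_left _ _))
  have hε1 : ε ≤ 1 := hε₇.trans ((min_le_right _ _).trans ((min_le_right _ _).trans (min_le_left _ _)))
  have hεμ : ε ≤ μQ1 / (2 * CQ + 1) := hε₇.trans ((min_le_right _ _).trans ((min_le_right _ _).trans ((min_le_right _ _).trans (min_le_left _ _))))
  have hεε₆ : ε ≤ ε₆ :=
    hε₇.trans ((min_le_right _ _).trans ((min_le_right _ _).trans ((min_le_right _ _).trans ((min_le_right _ _).trans (min_le_left _ _)))))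
  have hεreg' : ε ≤ 1 / (256 * ((d : ℝ) + 1) * L) := hε₇.trans ((min_le_right _ _).trans ((min_le_right _ _).trans ((min_le_right _ _).trans
    ((min_le_right _ _).trans ((min_le_right _ _).trans (min_le_left _ _))))))
  have hεN' : ε ≤ 1 / (24576 * N) := hε₇.trans ((min_le_right _ _).trans ((min_le_right _ _).trans ((min_le_right _ _).trans
    ((min_le_right _ _).trans ((min_le_right _ _).trans (min_le_right _ _))))))
  have hεR1 : 2 * Mφ * Mφ' * ε ≤ 1 := by
    rw [← hKRdef]
    refine (mul_le_mul_of_nonneg_left hε1' hKR).trans ?_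
    rw [mul_one_div, div_le_one (by positivity)]; linarith
  have hδQ : CQ * ε ≤ μQ1 / 2 := by
    have h1 : CQ * ε ≤ CQ * (μQ1 / (2 * CQ + 1)) := mul_le_mul_of_nonneg_left hεμ hCQ
    have h2 : CQ * (μQ1 / (2 * CQ + 1)) ≤ μQ1 / 2 := by
      rw [mul_div_assoc', div_le_div_iff₀ (by positivity) (by norm_num)]; nlinarith
    exact h1.trans h2
  have hεreg : 2 * ((d : ℝ) + 1) * L * ε ≤ 1 / 128 := by
    have := mul_le_mul_of_nonneg_left hεreg' (by positivity : (0 : ℝ) ≤ 2 * ((d : ℝ) + 1) * L)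
    refine this.trans (le_of_eq ?_)
    field_simp; ring
  -- bonds in `U1` from the extensions' letters
  have hUb : ∀ b : Bond d (fineP L m), U b ∈ U1 𝔸 := fun b => by
    obtain ⟨y, κ'⟩ := b
    have h := hU1 (liftSite y) κ'
    rwa [B9Eq315QTorus.perCfg_apply, perSite_liftSite] at h
  have hU'b : ∀ b : Bond d (fineP L m), U' b ∈ U1 𝔸 := fun b => by
    obtain ⟨y, κ'⟩ := b
    have h := hU1' (liftSite y) κ'
    rwa [B9Eq315QTorus.perCfg_apply, perSite_liftSite] at h
  -- the effective distance `δ₀ = δ ∧ 2ε` for the two-background `δ_Q`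
  obtain ⟨δ₀, hδ₀def⟩ : ∃ δ₀ : ℝ, δ₀ = min δ (2 * ε) := ⟨_, rfl⟩
  have hδ₀ : 0 ≤ δ₀ := by rw [hδ₀def]; exact le_min hδ (by positivity)
  have hδ₀δ : δ₀ ≤ δ := by rw [hδ₀def]; exact min_le_left _ _
  have hδ₀N : δ₀ ≤ 1 / (12288 * ((2 * (d * L) + L + L : ℕ) : ℝ)) := by
    rw [← hNdef]
    refine (show δ₀ ≤ 2 * ε by rw [hδ₀def]; exact min_le_right _ _).trans ?_
    have := mul_le_mul_of_nonneg_left hεN' (by norm_num : (0 : ℝ) ≤ 2)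
    refine this.trans (le_of_eq ?_)
    field_simp; norm_num
  have hU'U₀ : ∀ b, ‖(U' b : 𝔸) - (U b : 𝔸)‖ ≤ δ₀ := fun b => by
    rw [hδ₀def, norm_sub_rev]
    refine le_min (hUU' b) ?_
    calc ‖(U b : 𝔸) - (U' b : 𝔸)‖ = ‖((U b : 𝔸) - 1) - ((U' b : 𝔸) - 1)‖ := by rw [sub_sub_sub_cancel_right]
      _ ≤ ‖(U b : 𝔸) - 1‖ + ‖(U' b : 𝔸) - 1‖ := norm_sub_le _ _
      _ ≤ 2 * ε := by linarith [hUε b, hU'ε b]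
  -- `Q(V)` against `Q(1)` (flat `δ_Q`), operator bounds, adjoint moduli — at `U` and at `U′`
  have hQdiff : ∀ (V : Bond d (fineP L m) → 𝔸ˣ) {β : ℝ} (hβ : β ≤ 1 / 64)
      (hV1 : ∀ (x : B7Prop1Explicit.Site d) (κ : Fin d), perCfg (fineP L m) V x κ ∈ U1 𝔸)
      (hregV : ∀ (y : TSite d m) (κ : Fin d) (r : Fin d → Fin L), ‖((Wcx L (perCfg (fineP L m) V) (cornerSite L y) κ (boxVec L r) : 𝔸ˣ) : 𝔸) - 1‖ ≤ β),
      (∀ b, ‖(V b : 𝔸) - 1‖ ≤ ε) → ∀ x : BondL2K ℂ d (fineP L m) c₀ W, ‖QtorusW L m hL φ V hβ hV1 hregV (c₁ := c₁) x -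
      QtorusW L m hL φ (fun _ => 1) (show (0 : ℝ) ≤ 1 / 64 by norm_num) (hU1_one L m) (hreg_one L m) (c₁ := c₁) x‖ ≤ CQ * ε * ‖x‖ := by
    intro V β hβ hV1 hregV hVε x
    refine (norm_QtorusW_sub_flat_le L m hL V hβ hV1 hregV (show (0 : ℝ) ≤ 1 / 64 by norm_num) (hU1_one L m) (hreg_one L m) hε hVε φ
      hMφ hφ hMφ' hφ' x).trans (le_of_eq ?_)
    rw [hCQdef]; ring
  have hQV : ∀ (V : Bond d (fineP L m) → 𝔸ˣ) {β : ℝ} (hβ : β ≤ 1 / 64)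
      (hV1 : ∀ (x : B7Prop1Explicit.Site d) (κ : Fin d), perCfg (fineP L m) V x κ ∈ U1 𝔸)
      (hregV : ∀ (y : TSite d m) (κ : Fin d) (r : Fin d → Fin L), ‖((Wcx L (perCfg (fineP L m) V) (cornerSite L y) κ (boxVec L r) : 𝔸ˣ) : 𝔸) - 1‖ ≤ β),
      (∀ b, ‖(V b : 𝔸) - 1‖ ≤ ε) → ∀ x : BondL2K ℂ d (fineP L m) c₀ W, ‖QtorusW L m hL φ V hβ hV1 hregV (c₀ := c₀) (c₁ := c₁) x‖ ≤ (MQ1 + CQ) * ‖x‖ := by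
    intro V β hβ hV1 hregV hVε x
    have h1 := hQ1 x
    have h2 := hQdiff V hβ hV1 hregV hVε x
    have h3 := norm_le_insert' (QtorusW L m hL φ V hβ hV1 hregV (c₀ := c₀) (c₁ := c₁) x)
      (QtorusW L m hL φ (fun _ => 1) (show (0 : ℝ) ≤ 1 / 64 by norm_num) (hU1_one L m) (hreg_one L m) (c₀ := c₀) (c₁ := c₁) x)
    have h4 : CQ * ε * ‖x‖ ≤ CQ * ‖x‖ := mul_le_mul_of_nonneg_right (mul_le_of_le_one_right hCQ hε1) (norm_nonneg x)
    linarith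
  have hQVadj : ∀ (V : Bond d (fineP L m) → 𝔸ˣ) {β : ℝ} (hβ : β ≤ 1 / 64)
      (hV1 : ∀ (x : B7Prop1Explicit.Site d) (κ : Fin d), perCfg (fineP L m) V x κ ∈ U1 𝔸)
      (hregV : ∀ (y : TSite d m) (κ : Fin d) (r : Fin d → Fin L), ‖((Wcx L (perCfg (fineP L m) V) (cornerSite L y) κ (boxVec L r) : 𝔸ˣ) : 𝔸) - 1‖ ≤ β),
      (∀ b, ‖(V b : 𝔸) - 1‖ ≤ ε) → ∀ y : BondL2K ℂ d m c₁ W,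
      μQ1 / 2 * ‖y‖ ≤ ‖LinearMap.adjoint (QtorusW L m hL φ V hβ hV1 hregV (c₀ := c₀) (c₁ := c₁)) y‖ := by
    intro V β hβ hV1 hregV hVε y
    have h1 := hQ1adj y
    have h2 : ‖LinearMap.adjoint (QtorusW L m hL φ V hβ hV1 hregV (c₀ := c₀) (c₁ := c₁) -
        QtorusW L m hL φ (fun _ => 1) (show (0 : ℝ) ≤ 1 / 64 by norm_num) (hU1_one L m) (hreg_one L m) (c₀ := c₀) (c₁ := c₁)) y‖ ≤ CQ * ε * ‖y‖ :=
      norm_adjoint_apply_le _ (by positivity) (fun x => by rw [LinearMap.sub_apply]; exact hQdiff V hβ hV1 hregV hVε x) y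
    rw [map_sub, LinearMap.sub_apply] at h2
    have h3 := norm_le_insert (LinearMap.adjoint (QtorusW L m hL φ V hβ hV1 hregV (c₀ := c₀) (c₁ := c₁)) y)
      (LinearMap.adjoint (QtorusW L m hL φ (fun _ => 1) (show (0 : ℝ) ≤ 1 / 64 by norm_num) (hU1_one L m) (hreg_one L m) (c₀ := c₀) (c₁ := c₁)) y)
    have h4 : CQ * ε * ‖y‖ ≤ μQ1 / 2 * ‖y‖ := mul_le_mul_of_nonneg_right hδQ (norm_nonneg _)
    linarith
  have hQU := hQV U hα1 hU1 hreg hUε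
  have hQU' := hQV U' hα1' hU1' hreg' hU'ε
  have hQUadj := hQVadj U hα1 hU1 hreg hUε
  have hQU'adj := hQVadj U' hα1' hU1' hreg' hU'ε
  -- the two-background `δ_Q` ((δ_Q)₂ §6), `U` as the base: `‖Q(U′)x − Q(U)x‖ ≤ C_Q·δ·‖x‖`
  have hQdiff₂ : ∀ x : BondL2K ℂ d (fineP L m) c₀ W,
      ‖QtorusW L m hL φ U' hα1' hU1' hreg' (c₁ := c₁) x - QtorusW L m hL φ U hα1 hU1 hreg (c₁ := c₁) x‖ ≤ CQ₂ * δ * ‖x‖ := fun x => by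
    refine (norm_QtorusW_sub_QtorusW_le_of_bonds L m hL U' hα1' hU1' hreg' U hα1 hU1 hreg hε hUε hεreg hδ₀ hδ₀N hU'U₀ φ
      (c₀ := c₀) (c₁ := c₁) hMφ hφ hMφ' hφ' x).trans ?_
    have h1 : Mφ' * Mφ * Real.sqrt (c₁ * Fintype.card (Bond d m) / c₀) * (75497472 * ((d : ℝ) + 1) * ((2 * (d * L) + L + L : ℕ) : ℝ) * δ₀) * ‖x‖
        = CQ₂ * δ₀ * ‖x‖ := by rw [hCQ₂def, hNdef]; ring
    rw [h1]
    exact mul_le_mul_of_nonneg_right (mul_le_mul_of_nonneg_left hδ₀δ hCQ₂) (norm_nonneg _)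
  -- the operator bound `MT` and the coercivity `γ₁` of `Δ_a`, at `U` and at `U′`, in the `laplaceAK` form
  have hMTV : ∀ (V : Bond d (fineP L m) → 𝔸ˣ) {β : ℝ} (hβ : β ≤ 1 / 64)
      (hV1 : ∀ (x : B7Prop1Explicit.Site d) (κ : Fin d), perCfg (fineP L m) V x κ ∈ U1 𝔸)
      (hregV : ∀ (y : TSite d m) (κ : Fin d) (r : Fin d → Fin L), ‖((Wcx L (perCfg (fineP L m) V) (cornerSite L y) κ (boxVec L r) : 𝔸ˣ) : 𝔸) - 1‖ ≤ β),
      (∀ b, ‖(V b : 𝔸) - 1‖ ≤ ε) →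
      (∀ (b : Bond d (fineP L m)) (v u : W), ⟪adTransportW φ V b v, u⟫_ℂ = ⟪v, adTransportW φ (fun b => (V b)⁻¹) b u⟫_ℂ) →
      ∀ x : BondL2K ℂ d (fineP L m) c₀ W,
      ‖laplaceAK (hessOp φ η V τ) (covDerivL2K ℂ c₀ ((η : ℂ))⁻¹ (adTransportW φ V)) (RofU L m φ η V)
        (covDivL2K ℂ c₀ ((η : ℂ))⁻¹ (adTransportW φ fun b => (V b)⁻¹)) (QtorusW L m hL φ V hβ hV1 hregV (c₀ := c₀) (c₁ := c₁))
        (LinearMap.adjoint (QtorusW L m hL φ V hβ hV1 hregV (c₀ := c₀) (c₁ := c₁))) (RCLike.ofReal a) x‖ ≤ MT * ‖x‖ := by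
    intro V β hβ hV1 hregV hVε hRSV x
    have hMTU := norm_laplaceAofBackground_le L m hL φ hMφ hMφ' hφ hφ' τ hτ hCτ (η := η) a V hβ hV1 hregV hε hεR1 hVε hRSV (by positivity)
      (hQV V hβ hV1 hregV hVε)
    refine (hMTU x).trans (mul_le_mul_of_nonneg_right ?_ (norm_nonneg _))
    rw [hMTdef]
    have h1 : 32 * d * Cτ * Mφ ^ 2 * (|η| ^ d / c₀) * (‖((η : ℂ))⁻¹‖ ^ 2 * (4 * ε)) ≤
        32 * d * Cτ * Mφ ^ 2 * (|η| ^ d / c₀) * (‖((η : ℂ))⁻¹‖ ^ 2 * (4 * 1)) := by gcongr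
    linarith
  have hMT := hMTV U hα1 hU1 hreg hUε hRS
  have hMT' := hMTV U' hα1' hU1' hreg' hU'ε hRS'
  have hcoer : ∀ x : BondL2K ℂ d (fineP L m) c₀ W, γ₁ * ‖x‖ ^ 2 ≤ RCLike.re ⟪x,
      laplaceAK (hessOp φ η U τ) (covDerivL2K ℂ c₀ ((η : ℂ))⁻¹ (adTransportW φ U)) (RofU L m φ η U)
        (covDivL2K ℂ c₀ ((η : ℂ))⁻¹ (adTransportW φ fun b => (U b)⁻¹)) (QtorusW L m hL φ U hα1 hU1 hreg (c₀ := c₀) (c₁ := c₁))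
        (LinearMap.adjoint (QtorusW L m hL φ U hα1 hU1 hreg (c₀ := c₀) (c₁ := c₁))) (RCLike.ofReal a) x⟫_ℂ :=
    fun x => Hc U hα1 hU1 hreg hε hεε₃ hUε hRS x
  have hcoer' : ∀ x : BondL2K ℂ d (fineP L m) c₀ W, γ₁ * ‖x‖ ^ 2 ≤ RCLike.re ⟪x,
      laplaceAK (hessOp φ η U' τ) (covDerivL2K ℂ c₀ ((η : ℂ))⁻¹ (adTransportW φ U')) (RofU L m φ η U')
        (covDivL2K ℂ c₀ ((η : ℂ))⁻¹ (adTransportW φ fun b => (U' b)⁻¹)) (QtorusW L m hL φ U' hα1' hU1' hreg' (c₀ := c₀) (c₁ := c₁))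
        (LinearMap.adjoint (QtorusW L m hL φ U' hα1' hU1' hreg' (c₀ := c₀) (c₁ := c₁))) (RCLike.ofReal a) x⟫_ℂ :=
    fun x => Hc U' hα1' hU1' hreg' hε hεε₃ hU'ε hRS' x
  have hposU : ∀ x : BondL2K ℂ d (fineP L m) c₀ W, x ≠ 0 → 0 < RCLike.re ⟪x,
      laplaceAK (hessOp φ η U τ) (covDerivL2K ℂ c₀ ((η : ℂ))⁻¹ (adTransportW φ U)) (RofU L m φ η U)
        (covDivL2K ℂ c₀ ((η : ℂ))⁻¹ (adTransportW φ fun b => (U b)⁻¹)) (QtorusW L m hL φ U hα1 hU1 hreg (c₀ := c₀) (c₁ := c₁))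
        (LinearMap.adjoint (QtorusW L m hL φ U hα1 hU1 hreg (c₀ := c₀) (c₁ := c₁))) (RCLike.ofReal a) x⟫_ℂ := hpos
  have hposU' : ∀ x : BondL2K ℂ d (fineP L m) c₀ W, x ≠ 0 → 0 < RCLike.re ⟪x,
      laplaceAK (hessOp φ η U' τ) (covDerivL2K ℂ c₀ ((η : ℂ))⁻¹ (adTransportW φ U')) (RofU L m φ η U')
        (covDivL2K ℂ c₀ ((η : ℂ))⁻¹ (adTransportW φ fun b => (U' b)⁻¹)) (QtorusW L m hL φ U' hα1' hU1' hreg' (c₀ := c₀) (c₁ := c₁))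
        (LinearMap.adjoint (QtorusW L m hL φ U' hα1' hU1' hreg' (c₀ := c₀) (c₁ := c₁))) (RCLike.ofReal a) x⟫_ℂ := hpos'
  -- `δ_Δ`: the data difference in the `laplaceAK` form (`U′` minus `U`)
  have hδT : ∀ x : BondL2K ℂ d (fineP L m) c₀ W,
      ‖laplaceAK (hessOp φ η U' τ) (covDerivL2K ℂ c₀ ((η : ℂ))⁻¹ (adTransportW φ U')) (RofU L m φ η U')
          (covDivL2K ℂ c₀ ((η : ℂ))⁻¹ (adTransportW φ fun b => (U' b)⁻¹)) (QtorusW L m hL φ U' hα1' hU1' hreg' (c₀ := c₀) (c₁ := c₁))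
          (LinearMap.adjoint (QtorusW L m hL φ U' hα1' hU1' hreg' (c₀ := c₀) (c₁ := c₁))) (RCLike.ofReal a) x -
        laplaceAK (hessOp φ η U τ) (covDerivL2K ℂ c₀ ((η : ℂ))⁻¹ (adTransportW φ U)) (RofU L m φ η U)
          (covDivL2K ℂ c₀ ((η : ℂ))⁻¹ (adTransportW φ fun b => (U b)⁻¹)) (QtorusW L m hL φ U hα1 hU1 hreg (c₀ := c₀) (c₁ := c₁))
          (LinearMap.adjoint (QtorusW L m hL φ U hα1 hU1 hreg (c₀ := c₀) (c₁ := c₁))) (RCLike.ofReal a) x‖ ≤ CΔ * δ * ‖x‖ := fun x => by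
    rw [norm_sub_rev]; exact HΔ U U' hα1 hU1 hreg hα1' hU1' hreg' hε hεε₆ hδ hUb hU'b hUε hU'ε hUU' hRS hRS' x
  have hμ2 : 0 < μQ1 / 2 := by positivity
  refine ⟨fun z => ?_, fun b => ?_⟩
  · have h := norm_G1K_sub_le (𝕜 := ℂ) (E := BondL2K ℂ d (fineP L m) c₀ W) (F := BondL2K ℂ d m c₁ W) (S := SiteL2K ℂ d (fineP L m) c₀ W)
      (Δ₁ := hessOp φ η U τ (c₀ := c₀)) (Δ₂ := hessOp φ η U' τ (c₀ := c₀))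
      (D₁ := covDerivL2K ℂ c₀ ((η : ℂ))⁻¹ (adTransportW φ U)) (D₂ := covDerivL2K ℂ c₀ ((η : ℂ))⁻¹ (adTransportW φ U'))
      (R₁ := RofU L m φ η U (c₀ := c₀)) (R₂ := RofU L m φ η U' (c₀ := c₀))
      (Ds₁ := covDivL2K ℂ c₀ ((η : ℂ))⁻¹ (adTransportW φ fun b => (U b)⁻¹))
      (Ds₂ := covDivL2K ℂ c₀ ((η : ℂ))⁻¹ (adTransportW φ fun b => (U' b)⁻¹))
      (Q₁ := QtorusW L m hL φ U hα1 hU1 hreg (c₀ := c₀) (c₁ := c₁))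
      (Q₂ := QtorusW L m hL φ U' hα1' hU1' hreg' (c₀ := c₀) (c₁ := c₁))
      (a := RCLike.ofReal a) (γ := γ₁) (δT := CΔ * δ) hγ₁ hcoer hcoer' hposU hposU' (by positivity) hδT z
    have h' : ‖G1LatticeK (Δ₁ := hessOp φ η U τ) (Q := QtorusW L m hL φ U hα1 hU1 hreg (c₀ := c₀) (c₁ := c₁)) hpos z -
        G1LatticeK (Δ₁ := hessOp φ η U' τ) (Q := QtorusW L m hL φ U' hα1' hU1' hreg' (c₀ := c₀) (c₁ := c₁)) hpos' z‖ ≤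
        γ₁⁻¹ * (CΔ * δ) * γ₁⁻¹ * ‖z‖ := h
    exact h'.trans (le_of_eq (by ring))
  · have h := norm_H1K_sub_le (𝕜 := ℂ) (E := BondL2K ℂ d (fineP L m) c₀ W) (F := BondL2K ℂ d m c₁ W) (S := SiteL2K ℂ d (fineP L m) c₀ W)
      (Δ₁ := hessOp φ η U τ (c₀ := c₀)) (Δ₂ := hessOp φ η U' τ (c₀ := c₀))
      (D₁ := covDerivL2K ℂ c₀ ((η : ℂ))⁻¹ (adTransportW φ U)) (D₂ := covDerivL2K ℂ c₀ ((η : ℂ))⁻¹ (adTransportW φ U'))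
      (R₁ := RofU L m φ η U (c₀ := c₀)) (R₂ := RofU L m φ η U' (c₀ := c₀))
      (Ds₁ := covDivL2K ℂ c₀ ((η : ℂ))⁻¹ (adTransportW φ fun b => (U b)⁻¹))
      (Ds₂ := covDivL2K ℂ c₀ ((η : ℂ))⁻¹ (adTransportW φ fun b => (U' b)⁻¹))
      (Q₁ := QtorusW L m hL φ U hα1 hU1 hreg (c₀ := c₀) (c₁ := c₁))
      (Q₂ := QtorusW L m hL φ U' hα1' hU1' hreg' (c₀ := c₀) (c₁ := c₁))
      (a := RCLike.ofReal a) (γ := γ₁) (MT := MT) (δT := CΔ * δ) hγ₁ hcoer hcoer' hMT hMT' hposU hposU' (by positivity) hδT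
      (MQ := MQ1 + CQ) (μQ := μQ1 / 2) (δQ := CQ₂ * δ) (by positivity) hμ2 (by positivity) hQU hQU' hQUadj hQU'adj hQdiff₂
      (fun x' y' => (LinearMap.adjoint_inner_right _ x' y').symm) (adjoint_injective_of_modulus hμ2 hQUadj)
      (fun x' y' => (LinearMap.adjoint_inner_right _ x' y').symm) (adjoint_injective_of_modulus hμ2 hQU'adj) hMT0 b
    have h' : ‖H1LatticeK (Δ₁ := hessOp φ η U τ) (Q := QtorusW L m hL φ U hα1 hU1 hreg (c₀ := c₀) (c₁ := c₁)) hpos hQs b -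
        H1LatticeK (Δ₁ := hessOp φ η U' τ) (Q := QtorusW L m hL φ U' hα1' hU1' hreg' (c₀ := c₀) (c₁ := c₁)) hpos' hQs' b‖ ≤
        (γ₁⁻¹ * (CΔ * δ) * γ₁⁻¹ * ((MQ1 + CQ) * (γ₁ * (μQ1 / 2) ^ 2 / MT ^ 2)⁻¹) + γ₁⁻¹ * (CQ₂ * δ * (γ₁ * (μQ1 / 2) ^ 2 / MT ^ 2)⁻¹) +
          γ₁⁻¹ * ((MQ1 + CQ) * ((γ₁ * (μQ1 / 2) ^ 2 / MT ^ 2)⁻¹ * (CQ₂ * δ * (γ₁⁻¹ * (MQ1 + CQ)) +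
            (MQ1 + CQ) * (γ₁⁻¹ * (CΔ * δ) * γ₁⁻¹ * (MQ1 + CQ)) + (MQ1 + CQ) * (γ₁⁻¹ * (CQ₂ * δ))) * (γ₁ * (μQ1 / 2) ^ 2 / MT ^ 2)⁻¹))) * ‖b‖ := h
    rw [← hκdef] at h'
    refine h'.trans ?_
    have hslack : 0 ≤ δ * ‖b‖ := mul_nonneg hδ (norm_nonneg b)
    have hring : (γ₁⁻¹ * (CΔ * δ) * γ₁⁻¹ * ((MQ1 + CQ) * κ⁻¹) + γ₁⁻¹ * (CQ₂ * δ * κ⁻¹) +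
          γ₁⁻¹ * ((MQ1 + CQ) * (κ⁻¹ * (CQ₂ * δ * (γ₁⁻¹ * (MQ1 + CQ)) +
            (MQ1 + CQ) * (γ₁⁻¹ * (CΔ * δ) * γ₁⁻¹ * (MQ1 + CQ)) + (MQ1 + CQ) * (γ₁⁻¹ * (CQ₂ * δ))) * κ⁻¹))) * ‖b‖ + δ * ‖b‖ =
        (γ₁⁻¹ * CΔ * γ₁⁻¹ * ((MQ1 + CQ) * κ⁻¹) + γ₁⁻¹ * (CQ₂ * κ⁻¹) +
          γ₁⁻¹ * ((MQ1 + CQ) * (κ⁻¹ * (CQ₂ * (γ₁⁻¹ * (MQ1 + CQ)) + (MQ1 + CQ) * (γ₁⁻¹ * CΔ * γ₁⁻¹ * (MQ1 + CQ)) + (MQ1 + CQ) * (γ₁⁻¹ * CQ₂)) * κ⁻¹)) + 1) *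
          δ * ‖b‖ := by ring
    exact (le_add_of_nonneg_right hslack).trans hring.le

end Assembled

end Literature.MathematicalPhysics.QuantumFieldTheory.Balaban1983to89.B9Eq386LipschitzH1TwoBackgrounds

end
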